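import Mathlib
import Summits.MatrixMultiplication.Statement
import Summits.MatrixMultiplication.MatrixMultiplication.Theorems.GraphEquationsInitialForms
import Summits.MatrixMultiplication.MatrixMultiplication.Theorems.GraphEquationsPureForms
import Summits.MatrixMultiplication.MatrixMultiplication.Theorems.GraphEquationsPureFormsNec
import Summits.MatrixMultiplication.MatrixMultiplication.Theorems.GraphEquationsIsolatedRank

/-!
# `Purification → H_mult` unconditionally; the split `S ↔ V ∧ Purification` is exact (`GraphEquations`, kernel M12)

Decomp-mm node «GraphEquations» (lens 5); attacked leaf `MultiplicityReduction` (`H_mult`);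
registered line «initform».  Target of the node, VERBATIM: `_root_.MatrixMultiplication`.

Kernels M9a/M9b proved `IsolatedForcesRank → (Purification ↔ H_mult)` and
`IsolatedForcesRank → (S ↔ V ∧ Purification)`, with the classical statement `IsolatedForcesRank`
(isolated fibre ⇒ full generic Jacobian rank, for ARBITRARY polynomial families) as a hypothesis.
Kernel M11 (`GraphEquationsIsolatedRank`) proved it for families of FORMS.  This module removes the
hypothesis altogether: the pure initial forms `P_o` of `EqSystem.PureIsolatedAt` are automatically
forms, because `F_q ↦ f_q = c_q − Σ_k a_{q₁k} b_{kq₂}` is INJECTIVE (left inverse `a, b ↦ 0`,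
`c_q ↦ F_q`) and maps the degree-`d` component of `P` to the weight-`2d` component of `P(f)`
(`w(a) = w(b) = 1`, `w(c) = 2`); a weighted-homogeneous `P(f)` of weight `m` therefore has
`P = P_{m/2}` (`P = 0` for odd `m`).

* `aeval_killAB_aeval_generator`, `aeval_generator_injective` — `F ↦ f` is injective;
* `isWeightedHomogeneous_aeval_generator` — forms of degree `d` go to weight `2d`;
* `isHomogeneous_of_isWeightedHomogeneous_aeval_generator` — the converse degree count;
* `EqSystem.PureIsolatedAt.initNondegAt` — pure isolated ⇒ initial-form nondegenerate, NO hypothesis;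
* `EqAdmissiblePure.eqAdmissibleInit`, `EqAdmissiblePure.omega_le` (`⇒ ω ≤ β`),
  `Purification.initialFormReduction : Purification → H_init`,
  `Purification.multiplicityReduction : Purification → H_mult`,
  `multiplicityReduction_iff_purification : H_mult ↔ Purification`,
  `matrixMultiplication_of_graphEquationsQuadratic_of_purification : V → Purification → S`,
  `matrixMultiplication_iff_graphEquationsQuadratic_and_purification : S ↔ V ∧ Purification` — EXACT,
  unconditionally.

Consequence for line «initform» (`Cruxes/MultiplicityReduction/Lines/initform.lean`): its stub
`stub_isolatedForcesRank` is no longer load-bearing — `Purification.multiplicityReduction` composes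
the crux from `stub_purification` alone; the open core of `H_mult` is exactly `Purification`.

No `sorry`, no definitions.  Sources: [BurgisserClausenShokrollahi1997, Problem 16.3];
[Strassen1973]; [Humphreys1990, § 3.10] and [NeuselSmith2010, Prop. A.3.6] via kernel M11.
-/

set_option linter.dupNamespace false

noncomputable section

open scoped BigOperators

namespace Summit.MatrixMultiplication.MatrixMultiplication.Theorems.GraphEquations

open MvPolynomial
open Literature.Computability.AlgebraicComplexity

variable {n : ℕ}

/-! ## `F ↦ f` is injective and doubles degrees into weights -/

/-- The substitution `F_q ↦ f_q` has the left inverse `a, b ↦ 0`, `c_q ↦ F_q`. -/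
theorem aeval_killAB_aeval_generator (P : MvPolynomial (Fin n × Fin n) ℂ) :
    aeval (fun v : GraphVars n => Sum.elim (fun _ => (0 : MvPolynomial (Fin n × Fin n) ℂ)) X v)
      (aeval (generator n) P) = P := by
  rw [← AlgHom.comp_apply, comp_aeval]
  have h : (fun q : Fin n × Fin n => aeval (fun v : GraphVars n =>
      Sum.elim (fun _ => (0 : MvPolynomial (Fin n × Fin n) ℂ)) X v) (generator n q)) = X := by
    funext q
    simp [generator]
  rw [h, aeval_X_left_apply]

/-- `F ↦ f` is injective on `ℂ[F]`. -/
theorem aeval_generator_injective :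
    Function.Injective (aeval (generator n) :
      MvPolynomial (Fin n × Fin n) ℂ →ₐ[ℂ] MvPolynomial (GraphVars n) ℂ) := by
  intro P₁ P₂ h
  have h' := congrArg (aeval (fun v : GraphVars n =>
    Sum.elim (fun _ => (0 : MvPolynomial (Fin n × Fin n) ℂ)) X v)) h
  simpa only [aeval_killAB_aeval_generator] using h'

/-- `F ↦ f` maps forms of degree `d` to weighted-homogeneous polynomials of weight `2d`. -/
theorem isWeightedHomogeneous_aeval_generator {P : MvPolynomial (Fin n × Fin n) ℂ} {d : ℕ}
    (hP : P.IsHomogeneous d) : IsWeightedHomogeneous (gw n) (aeval (generator n) P) (2 * d) := by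
  classical
  rw [P.as_sum, map_sum]
  refine IsWeightedHomogeneous.sum _ _ _ fun s hs => ?_
  have hdeg : s.degree = d := by
    by_contra hne
    exact (mem_support_iff.mp hs) (hP.coeff_eq_zero hne)
  rw [aeval_monomial, MvPolynomial.algebraMap_eq, Finsupp.prod_pow]
  have hprod : IsWeightedHomogeneous (gw n) (∏ q, generator n q ^ s q) (∑ q, s q • 2) :=
    IsWeightedHomogeneous.prod Finset.univ (fun q => generator n q ^ s q) (fun q => s q • 2)
      fun q _ => (isWeightedHomogeneous_generator q).pow (s q)
  have hsum : ∑ q, s q • 2 = 2 * d := by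
    simp_rw [smul_eq_mul]
    rw [← Finset.sum_mul, ← Finsupp.degree_eq_sum, hdeg, mul_comm]
  rw [← hsum]
  exact hprod.C_mul _

/-- A polynomial `P ∈ ℂ[F]` whose image `P(f)` is weighted-homogeneous of weight `m` is a form of
degree `m / 2` (and `P = 0` if `m` is odd): compare weight-`2i` components and use injectivity. -/
theorem isHomogeneous_of_isWeightedHomogeneous_aeval_generator {P : MvPolynomial (Fin n × Fin n) ℂ}
    {m : ℕ} (hPm : IsWeightedHomogeneous (gw n) (aeval (generator n) P) m) :
    P.IsHomogeneous (m / 2) := by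
  classical
  have hsum := sum_homogeneousComponent (φ := P)
  have haP : aeval (generator n) P =
      ∑ j ∈ Finset.range (P.totalDegree + 1), aeval (generator n) (homogeneousComponent j P) := by
    rw [← map_sum, hsum]
  have hcomp : ∀ i j : ℕ, weightedHomogeneousComponent (gw n) (2 * i)
      (aeval (generator n) (homogeneousComponent j P)) =
        if i = j then aeval (generator n) (homogeneousComponent j P) else 0 := by
    intro i j
    rw [weightedHomogeneousComponent_of_mem
      (isWeightedHomogeneous_aeval_generator (homogeneousComponent_isHomogeneous j P))]
    by_cases hij : i = j
    · rw [if_pos hij, if_pos (by rw [hij])]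
    · rw [if_neg hij, if_neg (by omega)]
  -- every component of the wrong degree dies
  have key : ∀ i, 2 * i ≠ m → homogeneousComponent i P = 0 := by
    intro i hi
    by_cases hiD : P.totalDegree < i
    · exact homogeneousComponent_eq_zero _ _ hiD
    have hmem : i ∈ Finset.range (P.totalDegree + 1) := Finset.mem_range.mpr (by omega)
    have hL : weightedHomogeneousComponent (gw n) (2 * i) (aeval (generator n) P) = 0 := by
      rw [weightedHomogeneousComponent_of_mem hPm, if_neg hi]
    rw [haP, map_sum, Finset.sum_eq_single i, hcomp, if_pos rfl] at hL
    · exact aeval_generator_injective (by rw [hL, map_zero])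
    · intro j _ hji
      rw [hcomp, if_neg (Ne.symm hji)]
    · intro h
      exact absurd hmem h
  rw [← hsum]
  refine IsHomogeneous.sum _ _ _ fun j _ => ?_
  by_cases h2 : 2 * j = m
  · rw [show j = m / 2 by omega]
    exact homogeneousComponent_isHomogeneous _ _
  · rw [key j h2]
    exact isHomogeneous_zero _ _ _

/-! ## Pure isolated ⇒ initial-form nondegenerate, unconditionally -/

namespace EqSystem

/-- **Pure isolated initial forms are nondegenerate initial forms** — no hypothesis: the pure forms
`P_o` are homogeneous of degree `m_o / 2` (`isHomogeneous_of_isWeightedHomogeneous_aeval_generator`)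
and an isolated fibre of forms forces rank `n²` (kernel M11, `isolatedForcesRank_of_isHomogeneous`). -/
theorem PureIsolatedAt.initNondegAt {E : EqSystem n} {K : ℕ} {x : GraphVars n → ℂ}
    (h : E.PureIsolatedAt K x) : E.InitNondegAt K x := by
  obtain ⟨m, P, hm, hinit, hiso⟩ := h
  have hP : ∀ o, (P o).IsHomogeneous (m o / 2) := fun o =>
    isHomogeneous_of_isWeightedHomogeneous_aeval_generator (m := m o) (by
      rw [← hinit o]
      exact weightedHomogeneousComponent_isWeightedHomogeneous (m o) _)
  obtain ⟨γ, hγ⟩ :=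
    isolatedForcesRank_of_isHomogeneous n E.tests.length (fun o => m o / 2) P hP hiso
  exact ⟨m, P, γ, hm, hinit, hγ⟩

end EqSystem

/-! ## The glue without `IsolatedForcesRank` -/

/-- `EqAdmissiblePure β → EqAdmissibleInit β`. -/
theorem EqAdmissiblePure.eqAdmissibleInit {β : ℝ} (h : EqAdmissiblePure β) :
    EqAdmissibleInit β := by
  obtain ⟨K, c, hc⟩ := h
  refine ⟨K, c, fun n hn => ?_⟩
  obtain ⟨E, hE, ⟨x, hx, hP⟩, hcost⟩ := hc n hn
  exact ⟨E, hE, ⟨x, hx, hP.initNondegAt⟩, hcost⟩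

/-- `EqAdmissiblePure β → ω ≤ β`. -/
theorem EqAdmissiblePure.omega_le {β : ℝ} (h : EqAdmissiblePure β) : omega ℂ ≤ β :=
  omega_le_of_eqAdmissibleInit h.eqAdmissibleInit

/-- **`Purification → H_init`.** -/
theorem Purification.initialFormReduction (hP : Purification) : InitialFormReduction :=
  fun β hβ hE β' hβ' => (hP β hβ hE β' hβ').eqAdmissibleInit

/-- **`Purification → H_mult`** (the crux `MultiplicityReduction` from `stub_purification` alone). -/
theorem Purification.multiplicityReduction (hP : Purification) : MultiplicityReduction :=
  multiplicityReduction_of_initialFormReduction hP.initialFormReduction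

/-- **`H_mult ↔ Purification`**: the re-typing of the open core is EXACT. -/
theorem multiplicityReduction_iff_purification : MultiplicityReduction ↔ Purification :=
  ⟨purification_of_multiplicityReduction, Purification.multiplicityReduction⟩

/-- **`V → Purification → S`.** -/
theorem matrixMultiplication_of_graphEquationsQuadratic_of_purification
    (hV : GraphEquationsQuadratic) (hP : Purification) : _root_.MatrixMultiplication :=
  matrixMultiplication_of_quadratic_of_initialFormReduction hV hP.initialFormReduction

/-- **`S ↔ V ∧ Purification`**: the split of the node is exact, unconditionally. -/
theorem matrixMultiplication_iff_graphEquationsQuadratic_and_purification :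
    _root_.MatrixMultiplication ↔ (GraphEquationsQuadratic ∧ Purification) :=
  ⟨fun hS => ⟨nec_quadratic hS, nec_purification hS⟩,
    fun h => matrixMultiplication_of_graphEquationsQuadratic_of_purification h.1 h.2⟩

end Summit.MatrixMultiplication.MatrixMultiplication.Theorems.GraphEquations

end
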